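import Summits.CriticalPhenomena.PercolationContinuityZ3.Theorems.PercNearOneGluingNoHeavyLowerTailNineTypeAnchor

/-!
# Nine-type oriented-antipodal programme for `Q44b`: all-H independence away from the `{5,7} × {8,9}` clash

Support file for crux `stmt-CriticalPhenomena-4575` (master-family programme, quadratic four-point row `Q44b`),
seat `prim-bnk-1` gen 17; memo `run/shared/lean/prim/prim-l12/FROM-prim-bnk-1-gen17-NINE-TYPE-ANCHOR.md` §9(d).

Setting as in `…NineTypeAnchor.lean` (typed CONT-configurations `𝒯`, up-set `𝔊` of goods containing the
HL-forced sets `t ∪ t'ᶜ`).  The HL-incompatibilities between types form the digraph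
`8,9 → 1,…,7`, `1,2 → 5,6,7`, `5,7 → 8,9`; its only cycle is `{5,7} ⇄ {8,9}`.

**Theorem (`NineType.low_exists_odd_target`, = gen 16 §9 "T1+T2" in abstract form).**  If all types lie in
`{1,…,7}` then every nonempty `𝒮 ⊆ 𝒯` has a good containing an odd number of its members (the rows
`[t ⊆ g]` are GF(2)-independent), hence `#𝒯 ≤ #𝔊` (`low_card_le`).

**Theorem (`NineType.allH_exists_odd_target`, unified).**  The same holds whenever the configuration does not
contain both a point of type in `{5,7}` and a point of type in `{8,9}` (the two maximal cases being types
`⊆ {1,…,7}` and types `⊆ {1,2,3,4,6,8,9}` = the anchor lemma); `#𝒯 ≤ #𝔊` (`allH_card_le`).  At law level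
(two-copy fibre expansion, paper) these are the packings of `Q44b`-terms whose type sets avoid the clash.

Proof: odd trace at a maximal member (as in the anchor file) plus the CONT type flow; for types `≤ 7` the
maximal members have type 1 or 2 with witnesses of types 5, 6, 7, while CONT confines all members to types
`1,2,3,4`.  Pure finite combinatorics; no named facts, no sorries, standard axioms.
-/

namespace Summit.CriticalPhenomena.PercolationContinuityZ3.Theorems

namespace NineType

open Finset

/-- Table fact (low types): within types `1,…,7` an HL-incompatible pair `(x, M)` has `M ∈ {1,2}` and
`x ∈ {5,6,7}`. -/
theorem low_incompatible : ∀ x M : ℕ, 1 ≤ x → x ≤ 7 → 1 ≤ M → M ≤ 7 → hlOK x M = false →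
    (M = 1 ∨ M = 2) ∧ (x = 5 ∨ x = 6 ∨ x = 7) := by
  intro x M hx1 hx7 hM1 hM7
  interval_cases x <;> interval_cases M <;> decide

/-- Table fact (low types): a type below a type in `{1,2}` lies in `{1,2,3,4}`. -/
theorem low_below_max : ∀ m M : ℕ, 1 ≤ m → m ≤ 7 → (M = 1 ∨ M = 2) → (m, M) ∈ contPairs →
    (m = 1 ∨ m = 2 ∨ m = 3 ∨ m = 4) := by
  intro m M hm1 hm7 hM h
  rcases hM with rfl | rfl <;> interval_cases m <;> simp_all [contPairs]

/-- Table fact (low types): a type in `{1,…,7}` above a type in `{1,2,3,4}` lies in `{1,2,3,4}`. -/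
theorem low_above_min : ∀ m S : ℕ, (m = 1 ∨ m = 2 ∨ m = 3 ∨ m = 4) → 1 ≤ S → S ≤ 7 →
    (m, S) ∈ contPairs → (S = 1 ∨ S = 2 ∨ S = 3 ∨ S = 4) := by
  intro m S hm hS1 hS7 h
  rcases hm with rfl | rfl | rfl | rfl <;> interval_cases S <;> simp_all [contPairs]

/-- Types in `{1,…,9}` other than `5, 7` are anchored. -/
theorem mem_anchorTypes_of_ne : ∀ x : ℕ, 1 ≤ x → x ≤ 9 → x ≠ 5 → x ≠ 7 → x ∈ anchorTypes := by
  intro x h1 h9 h5 h7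
  interval_cases x <;> simp_all [anchorTypes]

variable {α : Type*} [DecidableEq α] [Fintype α]

/-- **Low-type lemma (types `1,…,7`, odd-target form).**  In a CONT-configuration all of whose types lie in
`{1,…,7}`, with an up-set of goods containing the HL-forced sets, every nonempty subfamily has a good
containing an odd number of its members.  [this work; abstract form of gen 16 §9] -/
theorem low_exists_odd_target (𝒯 : Finset (Finset α)) (θ : Finset α → ℕ)
    (hθ : ∀ t ∈ 𝒯, 1 ≤ θ t ∧ θ t ≤ 7)
    (hcont : ∀ s ∈ 𝒯, ∀ t ∈ 𝒯, s ⊆ t → (θ s, θ t) ∈ contPairs)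
    (𝔊 : Finset (Finset α)) (hG : IsUpperSet (𝔊 : Set (Finset α)))
    (hHL : ∀ t ∈ 𝒯, ∀ t' ∈ 𝒯, hlOK (θ t) (θ t') = true → t ∪ t'ᶜ ∈ 𝔊)
    (𝒮 : Finset (Finset α)) (hS𝒯 : 𝒮 ⊆ 𝒯) (hne : 𝒮.Nonempty) :
    ∃ g ∈ 𝔊, Odd #(𝒮.filter (fun S => S ⊆ g)) := by
  by_contra hcon
  simp only [not_exists, not_and] at hcon
  have upG : ∀ {S T : Finset α}, S ∈ 𝔊 → S ⊆ T → T ∈ 𝔊 := fun {S T} hS hST => hG hST hS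
  -- Step (a): a maximal member has an HL-incompatible witness
  have stepA : ∀ M ∈ 𝒮, (∀ S ∈ 𝒮, M ⊆ S → S = M) → ∃ S₀ ∈ 𝒮, hlOK (θ S₀) (θ M) = false := by
    intro M hM hmax
    obtain ⟨R, _, hodd⟩ := StaircaseKleitman.exists_odd_trace 𝒮 M hM hmax
    set T : Finset α := Mᶜ ∪ R with hT
    have hfilt : 𝒮.filter (fun S => S ⊆ T) = 𝒮.filter (fun S => S ∩ M ⊆ R) := by
      refine Finset.filter_congr ?_
      intro S _
      exact StaircaseKleitman.subset_compl_union_iff S M R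
    have hoddT : Odd #(𝒮.filter (fun S => S ⊆ T)) := by rw [hfilt]; exact hodd
    have hpos : 0 < #(𝒮.filter (fun S => S ⊆ T)) := Nat.pos_of_ne_zero (fun h0 => by
      rw [h0] at hoddT; exact (Nat.not_odd_iff_even.2 (by decide)) hoddT)
    obtain ⟨S₀, hS₀⟩ := Finset.card_pos.1 hpos
    have hS₀𝒮 : S₀ ∈ 𝒮 := (Finset.mem_filter.1 hS₀).1
    have hS₀T : S₀ ⊆ T := (Finset.mem_filter.1 hS₀).2
    refine ⟨S₀, hS₀𝒮, ?_⟩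
    cases hok : hlOK (θ S₀) (θ M) with
    | false => rfl
    | true =>
      exfalso
      have hgood : S₀ ∪ Mᶜ ∈ 𝔊 := hHL S₀ (hS𝒯 hS₀𝒮) M (hS𝒯 hM) hok
      have hsub : S₀ ∪ Mᶜ ⊆ T := Finset.union_subset hS₀T Finset.subset_union_left
      exact hcon T (upG hgood hsub) hoddT
  have exists_max_above : ∀ S ∈ 𝒮, ∃ M ∈ 𝒮, S ⊆ M ∧ ∀ S' ∈ 𝒮, M ⊆ S' → S' = M := by
    intro S hS
    have habove : (𝒮.filter (fun S' => S ⊆ S')).Nonempty := ⟨S, Finset.mem_filter.2 ⟨hS, subset_rfl⟩⟩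
    obtain ⟨M, hM, hMmax⟩ := Finset.exists_max_image (𝒮.filter (fun S' => S ⊆ S')) card habove
    refine ⟨M, (Finset.mem_filter.1 hM).1, (Finset.mem_filter.1 hM).2, ?_⟩
    intro S' hS' hMS'
    have hS'f : S' ∈ 𝒮.filter (fun S'' => S ⊆ S'') :=
      Finset.mem_filter.2 ⟨hS', ((Finset.mem_filter.1 hM).2).trans hMS'⟩
    exact (Finset.eq_of_subset_of_card_le hMS' (hMmax S' hS'f)).symm
  have exists_min_below : ∀ S ∈ 𝒮, ∃ m ∈ 𝒮, m ⊆ S ∧ ∀ S' ∈ 𝒮, S' ⊆ m → S' = m := by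
    intro S hS
    have hbelow : (𝒮.filter (fun S' => S' ⊆ S)).Nonempty := ⟨S, Finset.mem_filter.2 ⟨hS, subset_rfl⟩⟩
    obtain ⟨m, hm, hmmin⟩ := Finset.exists_min_image (𝒮.filter (fun S' => S' ⊆ S)) card hbelow
    refine ⟨m, (Finset.mem_filter.1 hm).1, (Finset.mem_filter.1 hm).2, ?_⟩
    intro S' hS' hS'm
    have hS'f : S' ∈ 𝒮.filter (fun S'' => S'' ⊆ S) :=
      Finset.mem_filter.2 ⟨hS', hS'm.trans (Finset.mem_filter.1 hm).2⟩
    exact Finset.eq_of_subset_of_card_le hS'm (hmmin S' hS'f)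
  -- maximal members have type 1 or 2
  have maxType : ∀ M ∈ 𝒮, (∀ S ∈ 𝒮, M ⊆ S → S = M) → (θ M = 1 ∨ θ M = 2) := by
    intro M hM hmax
    obtain ⟨S₀, hS₀, hbad⟩ := stepA M hM hmax
    have h0 := hθ S₀ (hS𝒯 hS₀)
    have h1 := hθ M (hS𝒯 hM)
    exact (low_incompatible _ _ h0.1 h0.2 h1.1 h1.2 hbad).1
  -- every member has type in {1,2,3,4}
  have allType : ∀ S ∈ 𝒮, θ S = 1 ∨ θ S = 2 ∨ θ S = 3 ∨ θ S = 4 := by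
    intro S hS
    obtain ⟨m, hm, hmS, _⟩ := exists_min_below S hS
    obtain ⟨M, hM, hmM, hMmax⟩ := exists_max_above m hm
    have hMt := maxType M hM hMmax
    have hm0 := hθ m (hS𝒯 hm)
    have hmt := low_below_max _ _ hm0.1 hm0.2 hMt (hcont m (hS𝒯 hm) M (hS𝒯 hM) hmM)
    have hS0 := hθ S (hS𝒯 hS)
    exact low_above_min _ _ hmt hS0.1 hS0.2 (hcont m (hS𝒯 hm) S (hS𝒯 hS) hmS)
  -- contradiction at a maximal member: its witness would have type 5, 6 or 7
  obtain ⟨S₁, hS₁⟩ := hne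
  obtain ⟨M, hM, _, hMmax⟩ := exists_max_above S₁ hS₁
  obtain ⟨S₀, hS₀, hbad⟩ := stepA M hM hMmax
  have h0 := hθ S₀ (hS𝒯 hS₀)
  have h1 := hθ M (hS𝒯 hM)
  have h567 := (low_incompatible _ _ h0.1 h0.2 h1.1 h1.2 hbad).2
  rcases allType S₀ hS₀ with h | h | h | h <;> rcases h567 with h' | h' | h' <;> omega

/-- **Low-type lemma, counting form**: `#𝒯 ≤ #𝔊`.  [this work] -/
theorem low_card_le (𝒯 : Finset (Finset α)) (θ : Finset α → ℕ)
    (hθ : ∀ t ∈ 𝒯, 1 ≤ θ t ∧ θ t ≤ 7)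
    (hcont : ∀ s ∈ 𝒯, ∀ t ∈ 𝒯, s ⊆ t → (θ s, θ t) ∈ contPairs)
    (𝔊 : Finset (Finset α)) (hG : IsUpperSet (𝔊 : Set (Finset α)))
    (hHL : ∀ t ∈ 𝒯, ∀ t' ∈ 𝒯, hlOK (θ t) (θ t') = true → t ∪ t'ᶜ ∈ 𝔊) : #𝒯 ≤ #𝔊 :=
  card_le_card_of_odd_targets 𝒯 𝔊 (fun 𝒮 hS hne =>
    low_exists_odd_target 𝒯 θ hθ hcont 𝔊 hG hHL 𝒮 hS hne)

/-- **Unified all-H lemma (odd-target form).**  In a CONT-configuration with types in `{1,…,9}` that does NOT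
contain both a point of type `5` or `7` and a point of type `8` or `9`, every nonempty subfamily has a good
containing an odd number of its members (the all-H rows are GF(2)-independent).  [this work, memo §9(d)] -/
theorem allH_exists_odd_target (𝒯 : Finset (Finset α)) (θ : Finset α → ℕ)
    (hθ : ∀ t ∈ 𝒯, 1 ≤ θ t ∧ θ t ≤ 9)
    (hclash : ¬ ((∃ t ∈ 𝒯, θ t = 5 ∨ θ t = 7) ∧ (∃ t ∈ 𝒯, θ t = 8 ∨ θ t = 9)))
    (hcont : ∀ s ∈ 𝒯, ∀ t ∈ 𝒯, s ⊆ t → (θ s, θ t) ∈ contPairs)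
    (𝔊 : Finset (Finset α)) (hG : IsUpperSet (𝔊 : Set (Finset α)))
    (hHL : ∀ t ∈ 𝒯, ∀ t' ∈ 𝒯, hlOK (θ t) (θ t') = true → t ∪ t'ᶜ ∈ 𝔊)
    (𝒮 : Finset (Finset α)) (hS𝒯 : 𝒮 ⊆ 𝒯) (hne : 𝒮.Nonempty) :
    ∃ g ∈ 𝔊, Odd #(𝒮.filter (fun S => S ⊆ g)) := by
  by_cases h89 : ∃ t ∈ 𝒯, θ t = 8 ∨ θ t = 9
  · -- no point of type 5 or 7: all types anchored
    have h57 : ¬ ∃ t ∈ 𝒯, θ t = 5 ∨ θ t = 7 := fun h => hclash ⟨h, h89⟩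
    have hθ' : ∀ t ∈ 𝒯, θ t ∈ anchorTypes := by
      intro t ht
      have h := hθ t ht
      refine mem_anchorTypes_of_ne _ h.1 h.2 ?_ ?_
      · intro h5; exact h57 ⟨t, ht, Or.inl h5⟩
      · intro h7; exact h57 ⟨t, ht, Or.inr h7⟩
    exact anchor_exists_odd_target 𝒯 θ hθ' hcont 𝔊 hG hHL 𝒮 hS𝒯 hne
  · -- no point of type 8 or 9: all types ≤ 7
    have hθ' : ∀ t ∈ 𝒯, 1 ≤ θ t ∧ θ t ≤ 7 := by
      intro t ht
      have h := hθ t ht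
      refine ⟨h.1, ?_⟩
      by_contra hgt
      have h8 : θ t = 8 ∨ θ t = 9 := by omega
      exact h89 ⟨t, ht, h8⟩
    exact low_exists_odd_target 𝒯 θ hθ' hcont 𝔊 hG hHL 𝒮 hS𝒯 hne

/-- **Unified all-H lemma, counting form**: `#𝒯 ≤ #𝔊` for every CONT-configuration avoiding the
`{5,7} × {8,9}` clash.  [this work] -/
theorem allH_card_le (𝒯 : Finset (Finset α)) (θ : Finset α → ℕ)
    (hθ : ∀ t ∈ 𝒯, 1 ≤ θ t ∧ θ t ≤ 9)
    (hclash : ¬ ((∃ t ∈ 𝒯, θ t = 5 ∨ θ t = 7) ∧ (∃ t ∈ 𝒯, θ t = 8 ∨ θ t = 9)))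
    (hcont : ∀ s ∈ 𝒯, ∀ t ∈ 𝒯, s ⊆ t → (θ s, θ t) ∈ contPairs)
    (𝔊 : Finset (Finset α)) (hG : IsUpperSet (𝔊 : Set (Finset α)))
    (hHL : ∀ t ∈ 𝒯, ∀ t' ∈ 𝒯, hlOK (θ t) (θ t') = true → t ∪ t'ᶜ ∈ 𝔊) : #𝒯 ≤ #𝔊 :=
  card_le_card_of_odd_targets 𝒯 𝔊 (fun 𝒮 hS hne =>
    allH_exists_odd_target 𝒯 θ hθ hclash hcont 𝔊 hG hHL 𝒮 hS hne)

end NineType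

end Summit.CriticalPhenomena.PercolationContinuityZ3.Theorems
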